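import Summits.QuantumFields.YangMills.Theorems.VirialFluxGapPatchingCalculus
import Summits.QuantumFields.YangMills.Theorems.VirialFluxGapPatchingBudget
import Summits.QuantumFields.YangMills.Theorems.VirialFluxGapFixGenericFloor
import Summits.QuantumFields.YangMills.Theorems.VirialFluxGapFieldPatching
import Summits.QuantumFields.YangMills.Theorems.VirialFluxGapPeriodicSoftnessOfSmoothFrameField
import Summits.QuantumFields.YangMills.Theorems.VirialFluxGapResolventFieldDivergence
import Summits.QuantumFields.YangMills.Theorems.VirialFluxGapRingFrameDerivativeBounds
import HarnessLib

/-!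
# Route `VirialFluxGap` (YangMills): ASSEMBLY OF THE PATCHED EULER FIELD ON `X_fix`, PART I — point letters, the compactness floor of
# `det(H + λ⋆1)²` on the closed generic window, and the GENERIC POINT PACKAGE with the det-localiser

Toward the deciding crux `VirialFluxGap.PeriodicSoftness` (item stmt-QuantumFields-24141).  The assembled field is
`c_va = ψ(F/t₀)·(χ_reg·c¹_va + (1 − χ_reg)·C_va)` with `c¹ = 2·resolventCoeff fixFrameStd λ⋆ θ = θ·(H + λ⋆1)⁻¹g` the DET-LOCALISED resolvent
field (`θ = 1 − ψ(det²/δ′)`, ✓`tsupport_detLocaliser_subset` ⇒ `c¹` is smooth on the whole coordinate space with NO hypothesis) and `C` the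
central field (w3 lineage).  This file supplies what the assembly (Part II, `…AssemblyOfCentralField`) needs at a point:

* §1 point letters: `fixEmbed_tree` (slice-0 tree links of an `X_fix` point are `1`), `two_mul_resolventCoeff` ∕ `sum_two_mul_resolventCoeff_mul_frameGrad`
  (`c¹ = θ·A⁻¹g`, drive `θ·gᵀA⁻¹g`), ★ `sum_frameD_two_mul_resolventCoeff` (at a point with `det ≠ 0`, `θ = 1`, `∂θ = 0`: `div c¹ = 2·(E2)` of
  ✓`sum_frameD_resolventCoeff`), `abs_sum_mul_le_sqrt_mul_sqrt` (Cauchy–Schwarz), `sum_sq_le_of_abs_le_two` (mass-gradient norm);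
* §2 ★ `exists_detSq_floor` — `∃ δ₀ > 0` below `det(H + λ⋆1)²` on the CLOSED generic window {`ρ′`-regular, `F_fix ≤ t_G`} (closed in the compact
  `X_fix`, ✓`fix_generic_isUnit_det_window`, `IsCompact.exists_forall_le'`);
* §3 ★★ `generic_point_package` — with `2δ′ ≤ det²` on the window and `t₀ ≤ t_G`: at every `ρ′`-regular `x` with `F_fix x ≤ t₀`, `θ = 1` and
  `∂θ = 0` (✓`detLocaliser_eq_one` ∕ ✓`frameD_detLocaliser_eq_zero`), `0 ≤ gᵀA⁻¹g`, `(1−ε)F ≤ ½gᵀA⁻¹g`, `div c¹ ≤ #ι − 4 + 1/4`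
  (✓`fix_generic_*_window`), `|A⁻¹g|² ≤ #ι·2C₂L⁴·t₀/(λ⋆/2)²` (✓`fix_generic_resolvent_sq_le_window`, ✓`frameGrad_dot_self_le`).

HONEST LABEL: helpers; no field is assembled in THIS file; ⟨24141⟩, ⟨22884⟩ remain OPEN; the Yang–Mills mass gap is NOT proved; no summit is
proved by a line.  THEOREMS ONLY (0 `def`, 0 `sorry`), standard axioms.  Explicit-unit seat `ym-line-fcl-p3` g41 (cell ym-idea-1, free hands;
default assembler per LEAD ruling 2026-08-30T23:18Z), `--supports stmt-QuantumFields-24141`.  References: [cite: Luscher1983, §2]; [folklore].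
-/

set_option autoImplicit false

noncomputable section

open scoped Matrix BigOperators ContDiff Topology Quaternion
open MeasureTheory Set Matrix
open Literature.MathematicalPhysics.QuantumFieldTheory hiding SU2
open Literature.MathematicalPhysics.QuantumLattice
open Literature.MathematicalPhysics.QuantumFieldTheory.SUNBakryEmery (expSU coe_expSU matTop)

namespace Summit.QuantumFields.YangMills.Theorems.VirialFluxGap.FrameHessian

open Summit.QuantumFields.YangMills.Theorems.FemtoTransferGap
open Summit.QuantumFields.YangMills.Theorems.FemtoTransferGap.TT
open Summit.QuantumFields.YangMills.Theorems.FemtoTransferGap.TwoLattice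
open Summit.QuantumFields.YangMills.Theorems.FemtoTransferGap.TwoLattice.Flat
open Summit.QuantumFields.YangMills.Theorems.VirialFluxGap.RingDeficit
open Summit.QuantumFields.YangMills.Theorems.VirialFluxGap.FrameDerivative
open Summit.QuantumFields.YangMills.Theorems.VirialFluxGap.ResolventField
open Summit.QuantumFields.YangMills.Theorems.VirialFluxGap.RegularValley
open Summit.QuantumFields.YangMills.Theorems.VirialFluxGap.FixFrame
open Summit.QuantumFields.YangMills.Theorems.VirialFluxGap.RegCutoff
open Summit.QuantumFields.YangMills.Theorems.VirialFluxGap.FieldPatching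
open Summit.QuantumFields.YangMills.Theorems.VirialFluxGap.FixField
open Summit.QuantumFields.YangMills.Theorems.VirialFluxGap.PatchingBudget

variable {L : ℕ} [NeZero L]

open scoped Matrix.Norms.Frobenius

/-! ## §1 Point letters -/

omit [NeZero L] in
/-- The tree-gauge embedding of an `X_fix` point has slice-0 tree links `1`. [folklore] -/
theorem fixEmbed_tree (x : (OffIdx L → SU2) × ((Fin (2 * L - 1) → GaugeConfig 3 L SU2) × (Site 3 L → SU2))) (e : Edge 3 L)
    (he : treeEdge e = true) : ((Fin.cons (glue x.1) x.2.1 : Fin (2 * L - 1 + 1) → GaugeConfig 3 L SU2), x.2.2).1 0 e = 1 := by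
  show (Fin.cons (glue x.1) x.2.1 : Fin (2 * L - 1 + 1) → GaugeConfig 3 L SU2) 0 e = 1
  rw [Fin.cons_zero]
  exact glue_apply_of_tree x.1 he

section PointLetters

variable {ι : Type*} [Fintype ι] [DecidableEq ι]

/-- The det-localised resolvent coefficient: `2·resolventCoeff τ λ⋆ θ j M = θ(M)·((H + λ⋆1)⁻¹g)_j`. [folklore] -/
theorem two_mul_resolventCoeff (τ : ι → ((Fin (2 * L - 1 + 1) × Edge 3 L) ⊕ Site 3 L) → Matrix (Fin 2) (Fin 2) ℂ) (lam : ℝ)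
    (θ : ((Fin (2 * L - 1 + 1) → Edge 3 L → Matrix (Fin 2) (Fin 2) ℂ) × (Site 3 L → Matrix (Fin 2) (Fin 2) ℂ)) → ℝ) (j : ι)
    (M : (Fin (2 * L - 1 + 1) → Edge 3 L → Matrix (Fin 2) (Fin 2) ℂ) × (Site 3 L → Matrix (Fin 2) (Fin 2) ℂ)) :
    2 * resolventCoeff (L := L) τ lam θ j M =
      θ M * (((frameHess (L := L) τ M + lam • (1 : Matrix ι ι ℝ))⁻¹ *ᵥ frameGrad (L := L) τ M) j) := by
  unfold resolventCoeff; ring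

/-- The drive of the det-localised resolvent field: `Σ_j (2·resolventCoeff_j)·g_j = θ·gᵀ(H + λ⋆1)⁻¹g`. [folklore] -/
theorem sum_two_mul_resolventCoeff_mul_frameGrad (τ : ι → ((Fin (2 * L - 1 + 1) × Edge 3 L) ⊕ Site 3 L) → Matrix (Fin 2) (Fin 2) ℂ) (lam : ℝ)
    (θ : ((Fin (2 * L - 1 + 1) → Edge 3 L → Matrix (Fin 2) (Fin 2) ℂ) × (Site 3 L → Matrix (Fin 2) (Fin 2) ℂ)) → ℝ)
    (M : (Fin (2 * L - 1 + 1) → Edge 3 L → Matrix (Fin 2) (Fin 2) ℂ) × (Site 3 L → Matrix (Fin 2) (Fin 2) ℂ)) :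
    ∑ j, (2 * resolventCoeff (L := L) τ lam θ j M) * frameGrad (L := L) τ M j =
      θ M * (frameGrad (L := L) τ M ⬝ᵥ ((frameHess (L := L) τ M + lam • (1 : Matrix ι ι ℝ))⁻¹ *ᵥ frameGrad (L := L) τ M)) := by
  simp only [two_mul_resolventCoeff, dotProduct, Finset.mul_sum]
  exact Finset.sum_congr rfl fun j _ => by ring

/-- ★ The divergence of the det-localised resolvent field AT A GOOD POINT (`det ≠ 0`, `θ = 1`, `∂θ = 0` there): twice the (E2) expression of
✓`sum_frameD_resolventCoeff`. [folklore] -/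
theorem sum_frameD_two_mul_resolventCoeff {τ : ι → ((Fin (2 * L - 1 + 1) × Edge 3 L) ⊕ Site 3 L) → Matrix (Fin 2) (Fin 2) ℂ}
    (hτ : ∀ j w, (τ j w)ᴴ = -τ j w) (hτ0 : ∀ j w, (τ j w).trace = 0) (lam : ℝ)
    {θ : ((Fin (2 * L - 1 + 1) → Edge 3 L → Matrix (Fin 2) (Fin 2) ℂ) × (Site 3 L → Matrix (Fin 2) (Fin 2) ℂ)) → ℝ} (hθ : ContDiff ℝ ∞ θ)
    (hsupp : tsupport θ ⊆ {M | (frameHess (L := L) τ M + lam • (1 : Matrix ι ι ℝ)).det ≠ 0})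
    (P : (Fin (2 * L - 1 + 1) → GaugeConfig 3 L SU2) × (Site 3 L → SU2))
    (hdet : (frameHess (L := L) τ (ringCoord L P) + lam • (1 : Matrix ι ι ℝ)).det ≠ 0)
    (hθ1 : θ (ringCoord L P) = 1) (hθD : ∀ j, frameD (τ j) θ (ringCoord L P) = 0) :
    ∑ j, frameD (τ j) (fun M => 2 * resolventCoeff (L := L) τ lam θ j M) (ringCoord L P) =
      2 * ((1 / 2) * Matrix.trace ((frameHess (L := L) τ (ringCoord L P) + lam • (1 : Matrix ι ι ℝ))⁻¹ * frameHess (L := L) τ (ringCoord L P)) -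
        (1 / 2) * ∑ j, ((frameHess (L := L) τ (ringCoord L P) + lam • (1 : Matrix ι ι ℝ))⁻¹ *ᵥ
          ((fun j' k => frameD (τ j) (fun M => frameHess (L := L) τ M j' k) (ringCoord L P)) *ᵥ
            ((frameHess (L := L) τ (ringCoord L P) + lam • (1 : Matrix ι ι ℝ))⁻¹ *ᵥ frameGrad (L := L) τ (ringCoord L P)))) j) := by
  have h1 : ∀ j, frameD (τ j) (fun M => 2 * resolventCoeff (L := L) τ lam θ j M) (ringCoord L P) =
      2 * frameD (τ j) (resolventCoeff (L := L) τ lam θ j) (ringCoord L P) := fun j =>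
    frameD_const_mul (τ j) (contDiff_resolventCoeff τ lam hθ hsupp j) 2 _
  simp only [h1, ← Finset.mul_sum]
  rw [sum_frameD_resolventCoeff hτ hτ0 lam hθ hsupp P hdet]
  simp only [hθD, zero_mul, Finset.sum_const_zero, zero_add, hθ1, one_mul]

omit [DecidableEq ι] in
/-- Cauchy–Schwarz letter: `|Σ_j r_j d_j| ≤ √R·√D` when `Σ r² ≤ R`, `Σ d² ≤ D`. [folklore] -/
theorem abs_sum_mul_le_sqrt_mul_sqrt (r d : ι → ℝ) {R D : ℝ} (hR : ∑ j, r j * r j ≤ R) (hD : ∑ j, d j * d j ≤ D) :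
    |∑ j, r j * d j| ≤ Real.sqrt R * Real.sqrt D := by
  have hrr : 0 ≤ ∑ j, r j * r j := dpnn r
  have hR0 : 0 ≤ R := hrr.trans hR
  rw [← Real.sqrt_mul hR0]
  refine Real.abs_le_sqrt ?_
  calc (∑ j, r j * d j) ^ 2 ≤ (∑ j, r j * r j) * ∑ j, d j * d j := dpcs r d
    _ ≤ R * D := mul_le_mul hR hD (dpnn d) hR0

omit [DecidableEq ι] in
/-- Mass-gradient norm: if every frame derivative of `m` is `≤ 2` in absolute value, `Σ_j (∂_j m)² ≤ 4·#ι`. [folklore] -/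
theorem sum_sq_le_of_abs_le_two (d : ι → ℝ) (hd : ∀ j, |d j| ≤ 2) : ∑ j, d j * d j ≤ 4 * Fintype.card ι := by
  calc ∑ j, d j * d j ≤ ∑ _j : ι, (4 : ℝ) := Finset.sum_le_sum fun j _ => by
          have h := hd j; rw [abs_le] at h; nlinarith
    _ = 4 * Fintype.card ι := by simp [mul_comm]

end PointLetters

/-! ## §2 The compactness constant below `det(H + λ⋆1)²` on the closed generic window -/

/-- ★ **A uniform floor for `det(H + λ⋆1)²` on the closed generic window** (`ρ′`-regular points with `F_fix ≤ t_G`): there the shifted Hessian is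
invertible (✓`fix_generic_isUnit_det_window`), the window is COMPACT (closed in the compact group `X_fix`) and `det²` is continuous, so a positive
minimum `δ₀` exists. [folklore] -/
theorem exists_detSq_floor [DecidableEq (FixVar L × Fin 3)] {ρ' K ε : ℝ} (hρ' : 0 < ρ') (hρ'1 : ρ' ≤ 1) (hK : 0 ≤ K) (hε : 0 < ε) (hε1 : ε ≤ 1)
    (hK3 : ∀ (Y₁ Y₂ Y₃ : ((Fin (2 * L - 1 + 1) × Edge 3 L) ⊕ Site 3 L) → Matrix (Fin 2) (Fin 2) ℂ) (b₁ b₂ b₃ : ℝ), 0 ≤ b₁ → 0 ≤ b₂ → 0 ≤ b₃ →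
      (∀ w, ‖Y₁ w‖ ≤ b₁) → (∀ w, ‖Y₂ w‖ ≤ b₂) → (∀ w, ‖Y₃ w‖ ≤ b₃) → ∀ Q : ((Fin (2 * L - 1 + 1) → GaugeConfig 3 L SU2) × (Site 3 L → SU2)),
      |frameD Y₁ (frameD Y₂ (frameD Y₃ (ringPoly L))) (ringCoord L Q)| ≤ K * b₁ * b₂ * b₃) :
    ∃ δ₀ : ℝ, 0 < δ₀ ∧ ∀ x : (OffIdx L → SU2) × ((Fin (2 * L - 1) → GaugeConfig 3 L SU2) × (Site 3 L → SU2)),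
      ((∃ k : Fin 3, ρ' ^ 2 ≤ 1 - (su2Quat (wrapReps ((Fin.cons (glue x.1) x.2.1 : Fin (2 * L - 1 + 1) → GaugeConfig 3 L SU2) 0) k)).re ^ 2) ∨
          ρ' ^ 2 ≤ 1 - (su2Quat (x.2.2 0)).re ^ 2) →
      ringDeficit L (fun _ => false) ((Fin.cons (glue x.1) x.2.1 : Fin (2 * L - 1 + 1) → GaugeConfig 3 L SU2), x.2.2) ≤
        ρ' ^ 2 * ε ^ 3 * (ρ' ^ 2 / (1032960 * (L : ℝ) ^ 8)) ^ 2 /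
          (1032960 * 10000 * (L : ℝ) ^ 8 * (K + 1) ^ 2 * (Fintype.card (FixVar L × Fin 3) : ℝ) ^ 5) →
      δ₀ ≤ ((frameHess (L := L) fixFrameStd (ringCoord L ((Fin.cons (glue x.1) x.2.1 : Fin (2 * L - 1 + 1) → GaugeConfig 3 L SU2), x.2.2)) +
        (ε * (ρ' ^ 2 / (1032960 * (L : ℝ) ^ 8)) / 3) • (1 : Matrix (FixVar L × Fin 3) (FixVar L × Fin 3) ℝ)).det) ^ 2 := by
  classical
  haveI : CompactSpace ((OffIdx L → SU2) × ((Fin (2 * L - 1) → GaugeConfig 3 L SU2) × (Site 3 L → SU2))) := compactSpace_fixSpace (L := L)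
  set tG : ℝ := ρ' ^ 2 * ε ^ 3 * (ρ' ^ 2 / (1032960 * (L : ℝ) ^ 8)) ^ 2 /
          (1032960 * 10000 * (L : ℝ) ^ 8 * (K + 1) ^ 2 * (Fintype.card (FixVar L × Fin 3) : ℝ) ^ 5) with htG
  set lam : ℝ := (ε * (ρ' ^ 2 / (1032960 * (L : ℝ) ^ 8)) / 3) with hlam
  -- the closed window
  set S : Set ((OffIdx L → SU2) × ((Fin (2 * L - 1) → GaugeConfig 3 L SU2) × (Site 3 L → SU2))) :=
    ((⋃ k : Fin 3, {x | ρ' ^ 2 ≤ linkMass k (ringCoord L ((Fin.cons (glue x.1) x.2.1 : Fin (2 * L - 1 + 1) → GaugeConfig 3 L SU2), x.2.2))}) ∪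
        {x | ρ' ^ 2 ≤ seamMass (ringCoord L ((Fin.cons (glue x.1) x.2.1 : Fin (2 * L - 1 + 1) → GaugeConfig 3 L SU2), x.2.2))}) ∩
      {x | ringPoly L (ringCoord L ((Fin.cons (glue x.1) x.2.1 : Fin (2 * L - 1 + 1) → GaugeConfig 3 L SU2), x.2.2)) ≤ tG} with hS
  have hcontM := (continuous_ringCoord (L := L)).comp (continuous_fixEmbed (L := L))
  have hclosed : IsClosed S := by
    refine IsClosed.inter (IsClosed.union ?_ ?_) ?_
    · exact isClosed_iUnion_of_finite fun k => isClosed_le continuous_const ((contDiff_linkMass k).continuous.comp hcontM)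
    · exact isClosed_le continuous_const (contDiff_seamMass.continuous.comp hcontM)
    · exact isClosed_le ((contDiff_ringPoly (L := L)).continuous.comp hcontM) continuous_const
  have hcompact : IsCompact S := hclosed.isCompact
  -- `det²` is continuous and positive on `S`
  have hf : Continuous fun x : (OffIdx L → SU2) × ((Fin (2 * L - 1) → GaugeConfig 3 L SU2) × (Site 3 L → SU2)) =>
      ((frameHess (L := L) fixFrameStd (ringCoord L ((Fin.cons (glue x.1) x.2.1 : Fin (2 * L - 1 + 1) → GaugeConfig 3 L SU2), x.2.2)) +
        lam • (1 : Matrix (FixVar L × Fin 3) (FixVar L × Fin 3) ℝ)).det) ^ 2 :=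
    (contDiff_det_shiftedHess_sq (L := L) fixFrameStd lam).continuous.comp hcontM
  have hpos : ∀ x ∈ S, (0 : ℝ) < ((frameHess (L := L) fixFrameStd (ringCoord L ((Fin.cons (glue x.1) x.2.1 : Fin (2 * L - 1 + 1) → GaugeConfig 3 L SU2), x.2.2)) +
        lam • (1 : Matrix (FixVar L × Fin 3) (FixVar L × Fin 3) ℝ)).det) ^ 2 := by
    intro x hx
    obtain ⟨hreg, hF⟩ := hx
    have hfar : (∃ k : Fin 3, ρ' ^ 2 ≤ 1 - (su2Quat (wrapReps ((Fin.cons (glue x.1) x.2.1 : Fin (2 * L - 1 + 1) → GaugeConfig 3 L SU2) 0) k)).re ^ 2) ∨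
        ρ' ^ 2 ≤ 1 - (su2Quat (x.2.2 0)).re ^ 2 := by
      rcases hreg with hk | hs
      · obtain ⟨k, hk⟩ := Set.mem_iUnion.1 hk
        exact Or.inl ⟨k, by rw [← linkMass_fixEmbed]; exact hk⟩
      · exact Or.inr (by rw [← seamMass_fixEmbed]; exact hs)
    have hF' : ringDeficit L (fun _ => false) ((Fin.cons (glue x.1) x.2.1 : Fin (2 * L - 1 + 1) → GaugeConfig 3 L SU2), x.2.2) ≤ tG := by
      rw [ringDeficit_eq_ringPoly]; exact hF
    have hu := fix_generic_isUnit_det_window _ (fixEmbed_tree x) hρ' hρ'1 hfar hK hε hε1 hK3 hF'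
    exact sq_pos_iff.mpr hu.ne_zero
  obtain ⟨δ₀, hδ₀, hδ₀S⟩ := hcompact.exists_forall_le' hf.continuousOn hpos
  refine ⟨δ₀, hδ₀, fun x hreg hF => hδ₀S x ⟨?_, ?_⟩⟩
  · rcases hreg with ⟨k, hk⟩ | hs
    · exact Or.inl (Set.mem_iUnion.2 ⟨k, by rw [Set.mem_setOf_eq, linkMass_fixEmbed]; exact hk⟩)
    · exact Or.inr (by rw [Set.mem_setOf_eq, seamMass_fixEmbed]; exact hs)
  · rw [Set.mem_setOf_eq, ← ringDeficit_eq_ringPoly]; exact hF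


/-! ## §3 The generic point package -/

/-- ★★ **The generic point package.**  Fix `ρ′ ∈ (0,1]`, `K ≥ 0`, `ε ∈ (0,1]`, the trilinear bound `hK3`, a gradient–energy constant `C₂`, a window
`0 < t₀ ≤ t_G` and a floor `2δ′ ≤ det(H + λ⋆1)²` on the closed generic window (`λ⋆ = ερ′²/(3·1032960L⁸)`).  Then at every `ρ′`-regular point `x`
of `X_fix` with `F_fix x ≤ t₀`: the det-localiser `θ = 1 − ψ(det²/δ′)` equals `1` with vanishing frame derivatives, the resolvent drive is signed and
`≥ 2(1−ε)F`, the divergence of `c¹ = 2·resolventCoeff fixFrameStd λ⋆ θ` is `≤ #ι − 4 + 1/4`, and `|A⁻¹g|² ≤ #ι·2C₂L⁴·t₀/(λ⋆/2)²`. [cite: Luscher1983, §2] -/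
theorem generic_point_package [DecidableEq (FixVar L × Fin 3)] {ρ' K ε t₀ δ' C₂ : ℝ} (hρ' : 0 < ρ') (hρ'1 : ρ' ≤ 1) (hK : 0 ≤ K) (hε : 0 < ε) (hε1 : ε ≤ 1)
    (hK3 : ∀ (Y₁ Y₂ Y₃ : ((Fin (2 * L - 1 + 1) × Edge 3 L) ⊕ Site 3 L) → Matrix (Fin 2) (Fin 2) ℂ) (b₁ b₂ b₃ : ℝ), 0 ≤ b₁ → 0 ≤ b₂ → 0 ≤ b₃ →
      (∀ w, ‖Y₁ w‖ ≤ b₁) → (∀ w, ‖Y₂ w‖ ≤ b₂) → (∀ w, ‖Y₃ w‖ ≤ b₃) → ∀ Q : ((Fin (2 * L - 1 + 1) → GaugeConfig 3 L SU2) × (Site 3 L → SU2)),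
      |frameD Y₁ (frameD Y₂ (frameD Y₃ (ringPoly L))) (ringCoord L Q)| ≤ K * b₁ * b₂ * b₃)
    (hC₂0 : 0 ≤ C₂)
    (hC₂ : ∀ (Q : ((Fin (2 * L - 1 + 1) → GaugeConfig 3 L SU2) × (Site 3 L → SU2)))
      (Y : ((Fin (2 * L - 1 + 1) × Edge 3 L) ⊕ Site 3 L) → Matrix (Fin 2) (Fin 2) ℂ), (∀ w, (Y w)ᴴ = -Y w) → (∀ w, (Y w).trace = 0) →
      ∀ b : ℝ, 0 ≤ b → (∀ w, ‖Y w‖ ≤ b) →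
      (frameD Y (ringPoly L) (ringCoord L Q)) ^ 2 ≤ 2 * (C₂ * (L : ℝ) ^ 4 * b ^ 2) * ringDeficit L (fun _ => false) Q)
    (ht₀G : t₀ ≤ ρ' ^ 2 * ε ^ 3 * (ρ' ^ 2 / (1032960 * (L : ℝ) ^ 8)) ^ 2 /
          (1032960 * 10000 * (L : ℝ) ^ 8 * (K + 1) ^ 2 * (Fintype.card (FixVar L × Fin 3) : ℝ) ^ 5))
    (hδ' : 0 < δ')
    (hδ : ∀ x : (OffIdx L → SU2) × ((Fin (2 * L - 1) → GaugeConfig 3 L SU2) × (Site 3 L → SU2)),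
      ((∃ k : Fin 3, ρ' ^ 2 ≤ 1 - (su2Quat (wrapReps ((Fin.cons (glue x.1) x.2.1 : Fin (2 * L - 1 + 1) → GaugeConfig 3 L SU2) 0) k)).re ^ 2) ∨
          ρ' ^ 2 ≤ 1 - (su2Quat (x.2.2 0)).re ^ 2) →
      ringDeficit L (fun _ => false) ((Fin.cons (glue x.1) x.2.1 : Fin (2 * L - 1 + 1) → GaugeConfig 3 L SU2), x.2.2) ≤
        ρ' ^ 2 * ε ^ 3 * (ρ' ^ 2 / (1032960 * (L : ℝ) ^ 8)) ^ 2 /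
          (1032960 * 10000 * (L : ℝ) ^ 8 * (K + 1) ^ 2 * (Fintype.card (FixVar L × Fin 3) : ℝ) ^ 5) →
      2 * δ' ≤ ((frameHess (L := L) fixFrameStd (ringCoord L ((Fin.cons (glue x.1) x.2.1 : Fin (2 * L - 1 + 1) → GaugeConfig 3 L SU2), x.2.2)) +
        (ε * (ρ' ^ 2 / (1032960 * (L : ℝ) ^ 8)) / 3) • (1 : Matrix (FixVar L × Fin 3) (FixVar L × Fin 3) ℝ)).det) ^ 2)
    (x : (OffIdx L → SU2) × ((Fin (2 * L - 1) → GaugeConfig 3 L SU2) × (Site 3 L → SU2)))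
    (hreg : (∃ k : Fin 3, ρ' ^ 2 ≤ 1 - (su2Quat (wrapReps ((Fin.cons (glue x.1) x.2.1 : Fin (2 * L - 1 + 1) → GaugeConfig 3 L SU2) 0) k)).re ^ 2) ∨
          ρ' ^ 2 ≤ 1 - (su2Quat (x.2.2 0)).re ^ 2)
    (hF : ringDeficit L (fun _ => false) ((Fin.cons (glue x.1) x.2.1 : Fin (2 * L - 1 + 1) → GaugeConfig 3 L SU2), x.2.2) ≤ t₀) :
    (1 - deficitStep (((frameHess (L := L) fixFrameStd (ringCoord L ((Fin.cons (glue x.1) x.2.1 : Fin (2 * L - 1 + 1) → GaugeConfig 3 L SU2), x.2.2)) +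
        (ε * (ρ' ^ 2 / (1032960 * (L : ℝ) ^ 8)) / 3) • (1 : Matrix (FixVar L × Fin 3) (FixVar L × Fin 3) ℝ)).det) ^ 2 / δ') = 1) ∧
    (∀ va : FixVar L × Fin 3, frameD (fixFrameStd va)
        (fun M' : (Fin (2 * L - 1 + 1) → Edge 3 L → Matrix (Fin 2) (Fin 2) ℂ) × (Site 3 L → Matrix (Fin 2) (Fin 2) ℂ) =>
          1 - deficitStep (((frameHess (L := L) fixFrameStd M' +
            (ε * (ρ' ^ 2 / (1032960 * (L : ℝ) ^ 8)) / 3) • (1 : Matrix (FixVar L × Fin 3) (FixVar L × Fin 3) ℝ)).det) ^ 2 / δ'))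
        (ringCoord L ((Fin.cons (glue x.1) x.2.1 : Fin (2 * L - 1 + 1) → GaugeConfig 3 L SU2), x.2.2)) = 0) ∧
    0 ≤ frameGrad (L := L) fixFrameStd (ringCoord L ((Fin.cons (glue x.1) x.2.1 : Fin (2 * L - 1 + 1) → GaugeConfig 3 L SU2), x.2.2)) ⬝ᵥ
        ((frameHess (L := L) fixFrameStd (ringCoord L ((Fin.cons (glue x.1) x.2.1 : Fin (2 * L - 1 + 1) → GaugeConfig 3 L SU2), x.2.2)) +
          (ε * (ρ' ^ 2 / (1032960 * (L : ℝ) ^ 8)) / 3) • (1 : Matrix (FixVar L × Fin 3) (FixVar L × Fin 3) ℝ))⁻¹ *ᵥ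
          frameGrad (L := L) fixFrameStd (ringCoord L ((Fin.cons (glue x.1) x.2.1 : Fin (2 * L - 1 + 1) → GaugeConfig 3 L SU2), x.2.2))) ∧
    (1 - ε) * ringDeficit L (fun _ => false) ((Fin.cons (glue x.1) x.2.1 : Fin (2 * L - 1 + 1) → GaugeConfig 3 L SU2), x.2.2) ≤
      (1 / 2) * (frameGrad (L := L) fixFrameStd (ringCoord L ((Fin.cons (glue x.1) x.2.1 : Fin (2 * L - 1 + 1) → GaugeConfig 3 L SU2), x.2.2)) ⬝ᵥ
        ((frameHess (L := L) fixFrameStd (ringCoord L ((Fin.cons (glue x.1) x.2.1 : Fin (2 * L - 1 + 1) → GaugeConfig 3 L SU2), x.2.2)) +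
          (ε * (ρ' ^ 2 / (1032960 * (L : ℝ) ^ 8)) / 3) • (1 : Matrix (FixVar L × Fin 3) (FixVar L × Fin 3) ℝ))⁻¹ *ᵥ
          frameGrad (L := L) fixFrameStd (ringCoord L ((Fin.cons (glue x.1) x.2.1 : Fin (2 * L - 1 + 1) → GaugeConfig 3 L SU2), x.2.2)))) ∧
    (∑ va : FixVar L × Fin 3, frameD (fixFrameStd va)
        (fun M' : (Fin (2 * L - 1 + 1) → Edge 3 L → Matrix (Fin 2) (Fin 2) ℂ) × (Site 3 L → Matrix (Fin 2) (Fin 2) ℂ) =>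
          2 * resolventCoeff (L := L) fixFrameStd ((ε * (ρ' ^ 2 / (1032960 * (L : ℝ) ^ 8)) / 3))
            (fun M'' : (Fin (2 * L - 1 + 1) → Edge 3 L → Matrix (Fin 2) (Fin 2) ℂ) × (Site 3 L → Matrix (Fin 2) (Fin 2) ℂ) =>
              1 - deficitStep (((frameHess (L := L) fixFrameStd M'' +
                (ε * (ρ' ^ 2 / (1032960 * (L : ℝ) ^ 8)) / 3) • (1 : Matrix (FixVar L × Fin 3) (FixVar L × Fin 3) ℝ)).det) ^ 2 / δ')) va M')
        (ringCoord L ((Fin.cons (glue x.1) x.2.1 : Fin (2 * L - 1 + 1) → GaugeConfig 3 L SU2), x.2.2)) ≤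
      (Fintype.card (FixVar L × Fin 3) : ℝ) - 4 + 1 / 4) ∧
    ((frameHess (L := L) fixFrameStd (ringCoord L ((Fin.cons (glue x.1) x.2.1 : Fin (2 * L - 1 + 1) → GaugeConfig 3 L SU2), x.2.2)) +
          (ε * (ρ' ^ 2 / (1032960 * (L : ℝ) ^ 8)) / 3) • (1 : Matrix (FixVar L × Fin 3) (FixVar L × Fin 3) ℝ))⁻¹ *ᵥ
          frameGrad (L := L) fixFrameStd (ringCoord L ((Fin.cons (glue x.1) x.2.1 : Fin (2 * L - 1 + 1) → GaugeConfig 3 L SU2), x.2.2))) ⬝ᵥ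
      ((frameHess (L := L) fixFrameStd (ringCoord L ((Fin.cons (glue x.1) x.2.1 : Fin (2 * L - 1 + 1) → GaugeConfig 3 L SU2), x.2.2)) +
          (ε * (ρ' ^ 2 / (1032960 * (L : ℝ) ^ 8)) / 3) • (1 : Matrix (FixVar L × Fin 3) (FixVar L × Fin 3) ℝ))⁻¹ *ᵥ
          frameGrad (L := L) fixFrameStd (ringCoord L ((Fin.cons (glue x.1) x.2.1 : Fin (2 * L - 1 + 1) → GaugeConfig 3 L SU2), x.2.2))) ≤
      (Fintype.card (FixVar L × Fin 3) : ℝ) * (2 * (C₂ * (L : ℝ) ^ 4)) * t₀ / ((ε * (ρ' ^ 2 / (1032960 * (L : ℝ) ^ 8)) / 3) / 2) ^ 2 := by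
  classical
  set P : (Fin (2 * L - 1 + 1) → GaugeConfig 3 L SU2) × (Site 3 L → SU2) :=
    ((Fin.cons (glue x.1) x.2.1 : Fin (2 * L - 1 + 1) → GaugeConfig 3 L SU2), x.2.2) with hPdef
  set lam : ℝ := (ε * (ρ' ^ 2 / (1032960 * (L : ℝ) ^ 8)) / 3) with hlam
  have hPx : ∀ e : Edge 3 L, treeEdge e = true → P.1 0 e = 1 := fixEmbed_tree x
  have ht : ringDeficit L (fun _ => false) P ≤ ρ' ^ 2 * ε ^ 3 * (ρ' ^ 2 / (1032960 * (L : ℝ) ^ 8)) ^ 2 /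
      (1032960 * 10000 * (L : ℝ) ^ 8 * (K + 1) ^ 2 * (Fintype.card (FixVar L × Fin 3) : ℝ) ^ 5) := hF.trans ht₀G
  have hL0 : (0 : ℝ) < L := by exact_mod_cast NeZero.pos L
  have hlam2 : 0 < lam / 2 := by rw [hlam]; positivity
  -- the window facts of the generic region
  have hunit := fix_generic_isUnit_det_window P hPx hρ' hρ'1 hreg hK hε hε1 hK3 ht
  have hdrive := fix_generic_drive_lower_window P hPx hρ' hρ'1 hreg hK hε hε1 hK3 ht
  have hdivE2 := fix_generic_divergence_upper_window P hPx hρ' hρ'1 hreg hK hε hε1 hK3 ht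
  have hnonneg := fix_generic_drive_nonneg_window P hPx hρ' hρ'1 hreg hK hε hε1 hK3 ht
  have hrsq := fix_generic_resolvent_sq_le_window P hPx hρ' hρ'1 hreg hK hε hε1 hK3 ht
  have hgsq := frameGrad_dot_self_le (L := L) P hC₂
  -- the localiser is invisible here
  have hdet2 : 2 * δ' ≤ ((frameHess (L := L) fixFrameStd (ringCoord L P) + lam • (1 : Matrix (FixVar L × Fin 3) (FixVar L × Fin 3) ℝ)).det) ^ 2 :=
    hδ x hreg ht
  have hθ1 : 1 - deficitStep (((frameHess (L := L) fixFrameStd (ringCoord L P) + lam • (1 : Matrix (FixVar L × Fin 3) (FixVar L × Fin 3) ℝ)).det) ^ 2 / δ') = 1 :=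
    detLocaliser_eq_one fixFrameStd lam hδ' hdet2
  have hθD : ∀ va : FixVar L × Fin 3, frameD (fixFrameStd va)
      (fun M' : (Fin (2 * L - 1 + 1) → Edge 3 L → Matrix (Fin 2) (Fin 2) ℂ) × (Site 3 L → Matrix (Fin 2) (Fin 2) ℂ) =>
        1 - deficitStep (((frameHess (L := L) fixFrameStd M' + lam • (1 : Matrix (FixVar L × Fin 3) (FixVar L × Fin 3) ℝ)).det) ^ 2 / δ'))
      (ringCoord L P) = 0 := fun va => frameD_detLocaliser_eq_zero fixFrameStd lam hδ' hdet2 _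
  refine ⟨hθ1, hθD, hnonneg, hdrive, ?_, ?_⟩
  · -- divergence of `c¹`
    rw [sum_frameD_two_mul_resolventCoeff fixFrameStd_conjTranspose fixFrameStd_trace lam (contDiff_detLocaliser fixFrameStd lam δ')
      (tsupport_detLocaliser_subset fixFrameStd lam hδ') P hunit.ne_zero hθ1 hθD]
    linarith
  · -- size of the resolvent vector
    have hF0 : 0 ≤ ringDeficit L (fun _ => false) P := ringDeficit_nonneg _ _
    have h1 : frameGrad (L := L) fixFrameStd (ringCoord L P) ⬝ᵥ frameGrad (L := L) fixFrameStd (ringCoord L P) ≤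
        (Fintype.card (FixVar L × Fin 3) : ℝ) * (2 * (C₂ * (L : ℝ) ^ 4)) * t₀ :=
      hgsq.trans (mul_le_mul_of_nonneg_left hF (by positivity))
    rw [le_div_iff₀ (by positivity), mul_comm]
    exact hrsq.trans h1

end Summit.QuantumFields.YangMills.Theorems.VirialFluxGap.FrameHessian

end
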